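import Literature.AlgebraicGeometry.Modules.ModuleCechHZero
import Literature.AlgebraicGeometry.Modules.CechOrderedComputesCohomology
import Literature.AlgebraicGeometry.Morphisms.ProperCoherentCohomologyFiniteOverRing
import Literature.AlgebraicGeometry.Morphisms.FormalFunctionsModuleComplete
import Literature.Algebra.Homology.HomologyAddEquivTransfer
import HarnessLib

/-!
# The module Čech complex of a coherent sheaf on a PROPER scheme over an affine noetherian base has finitely
# generated cohomology (Görtz–Wedhorn II, Thm. 22.9, Thm. 23.17 / Cor. 23.18; EGA III 3.2.1; Mumford, *Abelian
# Varieties*, §5)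

Topic `AlgebraicGeometry/Modules`; namespace `Literature.AlgebraicGeometry.Modules`; a *proofs* file (theorems only; no
definition, no named fact, no instance, no notation).

The tree computes «cohomology and base change» in the MODULE Čech dialect of `Modules/ModuleCechComplex`
(`Modules.cechComplex 𝓥 L ρ = OrderedCech.sysComplex (sectionsSystem 𝓥 L ρ)`, an honest cochain complex of
`A`-modules through a base ring `ρ : A → Γ(X, 𝒪_X)`; `Ȟ⁰ = Γ(X, L)` in `Modules/ModuleCechHZero`; flat terms;
the Grothendieck complex `Modules/GrothendieckComplexKernelRepr`), but its finiteness / perfectness theorems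
(`Modules/ModuleCechPerfect`, `ModuleCechStratumFinite`) are typed for a PRODUCT `P ×_K T` over the affine base `T`
(dévissage over the prime strata of `T`).  The finiteness of coherent cohomology over an affine noetherian base is
meanwhile PROVED in full generality in the SHEAF dialect: `Morphisms/ProperCoherentCohomologyFiniteOverRing`
(`module_finite_ext_unit_of_isProper`: `Extⁿ_{𝒪_X}(𝒪_X, 𝓕)` is a finitely generated `A`-module for `X → Spec A`
proper, `A` noetherian, `𝓕` coherent — Görtz–Wedhorn II Cor. 23.18), and ordered Leray
(`Modules/CechOrderedComputesCohomology`: `Extⁿ⁺¹(𝒪_X, M) ≃+ Hⁿ⁺¹(Γ(X, Č•_ord(𝓤, M)))`, natural in `M`) reads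
`Ext` in the ordered sheaf Čech complex `CechOrd.complex` of `Modules/CechOrderedComplex`.  This file is the
dictionary between the two Čech dialects and the resulting theorems for an ARBITRARY proper `X → Spec A` (e.g. an
abelian scheme over an affine base, which is not a product):

* §1–§2 `Modules.exists_cechSectionsAddEquiv U M ρ` — additive bijections `Cech.Sections (CechOrd.faces U n) 0 M ⊤
  ≃+ OrderedCech.SysCochain (sectionsSystem U M ρ) n` between the degree-`n` cochains of the two models (same
  simplices `{s ⊆ ι // #s = n + 1}`, restriction along `⊤ ∩ U_s = U_s`), intertwining the differentials (same
  signs `(-1)^{#{b ∈ t | b < a}}`) and carrying the action of the global function `ρ(a)` to the scalar `a` — the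
  pattern of `Motives/CechCoverOrderedSections` (there for `𝒪_Y(D)` inside `K(Y)` on an integral `Y`), here for any
  `𝒪_X`-module, stated as an existence so that this file is theorems-only;
* §3 `Modules.exists_ext_addEquiv_homology_cechComplex` — for `g : X → B`, `B` affine, `G` affine-localizing:
  `Extⁿ⁺¹_{𝒪_X}(𝒪_X, G) ≃+ Hⁿ⁺¹(Č•(𝓤, G))` (`ρ = g♯ : Γ(B, 𝒪_B) → Γ(X, 𝒪_X)`), `Γ(B, 𝒪_B)`-semilinearly (ordered
  Leray + `Algebra/Homology/HomologyAddEquivTransfer`, semilinear by the naturality of the Leray isomorphism in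
  the module — the argument of `Morphisms/ProperHigherDirectImagesAffine`, §2, for the complex of modules itself
  rather than for the sections of the sheafified model), and
  **`Modules.module_finite_homology_cechComplex_of_isProper`** — for `g : X → B` PROPER, `B` affine locally
  noetherian, `G` coherent and a finite cover `𝓤` of `X` with affine finite intersections, every `Hⁱ(Č•(𝓤, G))` is
  a finitely generated `Γ(B, 𝒪_B)`-module (degree `0` through `kerDZeroEquiv` and the finiteness of `Γ(X, G)`,
  `Morphisms/FormalFunctionsModuleComplete.moduleFinite_msections_of_coh`);
* the Grothendieck complex (strictly perfect model) and its base change are the sequel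
  `Modules/GrothendieckComplexOfProper`.

Everything is proved; no named facts.  Universe: `Scheme.{0}` (the universe of
`Morphisms/ProperCoherentCohomologyFiniteOverRing` §4; the two Čech models index covers by `ι : Type u` resp.
`ι : Type`, which meet at `u = 0`).  The base is an arbitrary AFFINE scheme `B` with ring `Γ(B, 𝒪_B)` (as in
`Modules/ModuleCechPerfect`), so that affine base changes `B′ → B` compose without transport along `A ≅ Γ(Spec A, 𝒪)`.  Mathlib searched (pin): `HomologicalComplex.isoHomologyπ`,
`CategoryTheory.Iso.toLinearEquiv`, `LinearEquiv.ofEq`, `Module.Finite.equiv` (used); Mathlib has no Čech cohomology of quasi-coherent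
modules, no finiteness theorem for proper morphisms and no Grothendieck complex.  Cell `hodgecm-mathlib`, F-DAG
first hand (h2) «cohomology and base change» (B-p04 (g18) author; this is his LACKS-(ii) «Grothendieck complex of a
general proper flat `X → Spec A`»), B-p19 (g14); generic, count-neutral, books 0.

## References

* U. Görtz, T. Wedhorn, *Algebraic Geometry II: Cohomology of Schemes*, Springer Spektrum (2023),
  doi:10.1007/978-3-658-43031-3: Def. 21.64, Lemma 21.65, Def. 21.68 (pp. 179–180); Thm. 22.9 (p. 236);
  Thm. 23.17 and Cor. 23.18 (pp. 306–307). [GortzWedhorn2023]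
* U. Görtz, T. Wedhorn, *Algebraic Geometry I: Schemes*, 2nd ed. (2020), Cor. 7.42. [GortzWedhorn2020]
* D. Mumford, *Abelian Varieties*, TIFR Studies in Mathematics 5 (1970), §5, Lemmas 1–2 (pp. 46–50). [MumfordAV1970]
* A. Grothendieck, J. Dieudonné, EGA III₁ (Publ. Math. IHÉS 11, 1961), Thm. 3.2.1. [EGAIII1]
* A. Grothendieck, EGA III₂ (Publ. Math. IHÉS 17, 1963), (6.10.5). [EGA3]
-/

noncomputable section

set_option backward.isDefEq.respectTransparency false

universe w

open CategoryTheory CategoryTheory.Abelian CategoryTheory.Limits Opposite TopologicalSpace AlgebraicGeometry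
open Literature.Algebra.Homology

namespace Literature.AlgebraicGeometry.Modules

/-! ## §1 The two index types and the two families of opens -/

section Dictionary

-- Universe `0`: the sheaf Čech complex `Modules/CechObjects` indexes covers by a type in the universe of the
-- scheme, the module Čech complex `Modules/ModuleCechComplex` by a small type; they meet at `Scheme.{0}`, the
-- universe of `Morphisms/ProperCoherentCohomologyFiniteOverRing` §4.
variable {X : Scheme.{0}} {ι : Type} [LinearOrder ι] (U : ι → X.Opens) (M : X.Modules)
  {A : Type} [CommRing A] (ρ : A →+* Γ(X, ⊤))

omit [LinearOrder ι] in
/-- The two spellings of `U_s = ⋂_{i ∈ s} U_i` agree: `CechOrd.faceSet U s = Modules.cechOpen U s`.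
[cite: GortzWedhorn2023, Def. 21.64 (p. 179)] -/
theorem faceSet_eq_cechOpen (s : Finset ι) : CechOrd.faceSet U s = cechOpen U s :=
  le_antisymm (Finset.le_inf fun _ hi => CechOrd.faceSet_le hi) (le_iInf₂ fun _ hi => cechOpen_le U hi)

/-- `⊤ ∩ U_{β} ⊆ V_{β 0}`. [cite: GortzWedhorn2023, Def. 21.64 (p. 179)] -/
theorem top_inf_face_le {n : ℕ} (β : CechOrd.Idx ι n) :
    ⊤ ⊓ face (CechOrd.faces U n) β ≤ cechOpen U (β 0).1 := by
  rw [CechOrd.face_faces, faceSet_eq_cechOpen]; exact inf_le_right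

/-- `V_{β 0} ⊆ ⊤ ∩ U_{β}`. [cite: GortzWedhorn2023, Def. 21.64 (p. 179)] -/
theorem le_top_inf_face {n : ℕ} (β : CechOrd.Idx ι n) :
    cechOpen U (β 0).1 ≤ ⊤ ⊓ face (CechOrd.faces U n) β := by
  rw [CechOrd.face_faces, faceSet_eq_cechOpen]; exact le_inf le_top le_rfl

/-- Integer signs act on sections through the base ring: `(sign A s a) • x = (sgn s a) • x`. [folklore] -/
private theorem sign_smul_eq_sgn_smul {V : X.Opens} (s : Finset ι) (a : ι) (x : SecMod M ρ V) :
    (OrderedCech.sign A s a • x : SecMod M ρ V) = CechOrd.sgn s a • x := by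
  unfold OrderedCech.sign CechOrd.sgn
  rw [← Int.cast_smul_eq_zsmul A, Int.cast_pow, Int.cast_neg, Int.cast_one]

/-- `SecMod.val` of an integer multiple. [folklore] -/
private theorem val_zsmul {V : X.Opens} (k : ℤ) (x : SecMod M ρ V) :
    SecMod.val (L := M) (ρ := ρ) (k • x) = k • SecMod.val (L := M) (ρ := ρ) x :=
  map_zsmul (⟨⟨SecMod.val (L := M) (ρ := ρ), SecMod.val_zero⟩, SecMod.val_add⟩ : SecMod M ρ V →+ Γ(M, V)) k x

/-- `SecMod.val` of a finite sum. [folklore] -/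
private theorem val_sum {V : X.Opens} {κ : Type*} (t : Finset κ) (f : κ → SecMod M ρ V) :
    SecMod.val (L := M) (ρ := ρ) (∑ k ∈ t, f k) = ∑ k ∈ t, SecMod.val (L := M) (ρ := ρ) (f k) :=
  map_sum (⟨⟨SecMod.val (L := M) (ρ := ρ), SecMod.val_zero⟩, SecMod.val_add⟩ : SecMod M ρ V →+ Γ(M, V)) f t

/-! ## §2 The cochain dictionary -/

/-- **The two ordered Čech complexes have the same cochains, differentials and scalars.** There are additive
bijections `eₙ : Π_β Γ(M, ⊤ ∩ U_β) ≃+ Π_{#s = n+1} Γ(M, V_s)` (restriction along `⊤ ∩ U_s = V_s = U_s`) between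
the degree-`n` sections over `⊤` of the ordered sheaf Čech complex `Č•_ord(𝓤, M)` of `Modules/CechOrderedComplex`
and the degree-`n` cochains of the module Čech complex `Č•(𝓤, M)` of `Modules/ModuleCechComplex`, which
(1) intertwine the two differentials `(d c)_t = Σ_{a ∈ t} (-1)^{#{b ∈ t | b < a}} c_{t ∖ a}|_{U_t}` and (2) carry
the action of the global function `ρ(a)` (`a ∈ A`) on sections to the scalar `a` of the `A`-module structure
through `ρ`.  (Stated as an existence so that the file stays definition-free; the bijections are the evident
restrictions, cf. `Motives/CechCoverOrderedSections` for the function-field model.)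
[cite: GortzWedhorn2023, Def. 21.68 (p. 180)] -/
theorem exists_cechSectionsAddEquiv [Fintype ι] :
    ∃ e : ∀ n : ℕ, Cech.Sections (CechOrd.faces U n) 0 M ⊤ ≃+ OrderedCech.SysCochain (sectionsSystem U M ρ) (n : ℤ),
      (∀ (n : ℕ) (c : Cech.Sections (CechOrd.faces U n) 0 M ⊤),
        e (n + 1) ((CechOrd.d U M n).app ⊤ c) = OrderedCech.sysD (sectionsSystem U M ρ) (n : ℤ) (e n c)) ∧
      (∀ (n : ℕ) (a : A) (c : Cech.Sections (CechOrd.faces U n) 0 M ⊤), e n (ρ a • c) = a • e n c) := by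
  -- indices: `Fin 1 → {s // #s = n+1}` versus `{s // s ≠ ∅ ∧ #s = n+1}`
  let idx : ∀ m : ℕ, OrderedCech.Simplex ι (m : ℤ) → CechOrd.Idx ι m :=
    fun m σ _ => ⟨σ.1, by have := σ.2.2; omega⟩
  let spx : ∀ m : ℕ, CechOrd.Idx ι m → OrderedCech.Simplex ι (m : ℤ) :=
    fun m β => ⟨(β 0).1, Finset.card_pos.1 (by rw [(β 0).2]; omega), by rw [(β 0).2]; push_cast; ring⟩
  have idx_spx : ∀ (m : ℕ) (β : CechOrd.Idx ι m), idx m (spx m β) = β := fun m β => CechOrd.Idx.ext rfl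
  -- the two maps
  let toC : ∀ m : ℕ, Cech.Sections (CechOrd.faces U m) 0 M ⊤ → OrderedCech.SysCochain (sectionsSystem U M ρ) (m : ℤ) :=
    fun m c σ => SecMod.mk (ρ := ρ) (Cech.res M (le_top_inf_face U (idx m σ)) (c (idx m σ)))
  let ofC : ∀ m : ℕ, OrderedCech.SysCochain (sectionsSystem U M ρ) (m : ℤ) → Cech.Sections (CechOrd.faces U m) 0 M ⊤ :=
    fun m g β => Cech.res M (top_inf_face_le U β) (SecMod.val (L := M) (ρ := ρ) (g (spx m β)))
  have val_toC : ∀ (m : ℕ) (c : Cech.Sections (CechOrd.faces U m) 0 M ⊤) (σ : OrderedCech.Simplex ι (m : ℤ)),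
      SecMod.val (L := M) (ρ := ρ) (toC m c σ) = Cech.res M (le_top_inf_face U (idx m σ)) (c (idx m σ)) :=
    fun _ _ _ => rfl
  have ofC_apply : ∀ (m : ℕ) (g : OrderedCech.SysCochain (sectionsSystem U M ρ) (m : ℤ)) (β : CechOrd.Idx ι m),
      ofC m g β = Cech.res M (top_inf_face_le U β) (SecMod.val (L := M) (ρ := ρ) (g (spx m β))) :=
    fun _ _ _ => rfl
  have toC_add : ∀ (m : ℕ) (c c' : Cech.Sections (CechOrd.faces U m) 0 M ⊤), toC m (c + c') = toC m c + toC m c' :=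
    fun m c c' => funext fun σ => SecMod.val_injective (L := M) (ρ := ρ) (by
      change SecMod.val (L := M) (ρ := ρ) (toC m (c + c') σ) =
        SecMod.val (L := M) (ρ := ρ) (toC m c σ + toC m c' σ)
      rw [SecMod.val_add, val_toC, val_toC, val_toC, Cech.add_apply, map_add])
  let e : ∀ m : ℕ, Cech.Sections (CechOrd.faces U m) 0 M ⊤ ≃+ OrderedCech.SysCochain (sectionsSystem U M ρ) (m : ℤ) :=
    fun m =>
    { toFun := toC m
      invFun := ofC m
      left_inv := fun c => by
        funext β
        rw [ofC_apply, val_toC, Cech.res_res, CechOrd.res_apply_congr U M c (idx_spx m β) _ le_rfl, Cech.res_self]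
      right_inv := fun g => by
        funext σ
        apply SecMod.val_injective (L := M) (ρ := ρ)
        rw [val_toC, ofC_apply, Cech.res_res, Cech.res_self]
        rfl
      map_add' := toC_add m }
  have e_apply : ∀ (m : ℕ) (c : Cech.Sections (CechOrd.faces U m) 0 M ⊤), e m c = toC m c := fun _ _ => rfl
  refine ⟨e, fun n c => ?_, fun n a c => ?_⟩
  · -- (1) the differentials
    funext σ
    apply SecMod.val_injective (L := M) (ρ := ρ)
    rw [e_apply, e_apply, val_toC, CechOrd.d_app_apply_eq_sum_attach, OrderedCech.sysD_apply, map_sum, val_sum]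
    conv_rhs => rw [← Finset.sum_attach]
    refine Finset.sum_congr rfl fun a _ => ?_
    rw [map_zsmul, sign_smul_eq_sgn_smul, val_zsmul, Cech.res_res]
    congr 1
    -- right: `ext0At` at the face `σ ∖ a`, an `n`-simplex
    have hmem : (a : ι) ∈ σ.1 := a.2
    have hcardN : (σ.1.erase a).card = n + 1 := by
      have h1 : (σ.1.erase a).card = σ.1.card - 1 := Finset.card_erase_of_mem hmem
      have h2 : σ.1.card = n + 2 := by have := σ.2.2; omega
      omega
    have hcard : ((σ.1.erase a).card : ℤ) = n + 1 := by rw [hcardN]; push_cast; ring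
    have hne : (σ.1.erase a).Nonempty := Finset.card_pos.1 (by omega)
    let τ : OrderedCech.Simplex ι (n : ℤ) := ⟨σ.1.erase a, hne, hcard⟩
    change _ = SecMod.val (L := M) (ρ := ρ) ((toC n c).ext0At τ.1 σ.1)
    rw [OrderedCech.SysCochain.ext0At_val _ τ σ.1 (Finset.erase_subset _ _), sectionsSystem_map_apply,
      SecMod.val_res, val_toC]
    change _ = Cech.res M _ (Cech.res M _ (c (idx n τ)))
    rw [Cech.res_res]
    rfl
  · -- (2) the scalars
    funext σ
    apply SecMod.val_injective (L := M) (ρ := ρ)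
    change SecMod.val (L := M) (ρ := ρ) (toC n (ρ a • c) σ) = SecMod.val (L := M) (ρ := ρ) (a • toC n c σ)
    rw [val_toC, SecMod.smul_def, val_toC, Cech.smul_apply, Scheme.Modules.map_smul]
    congr 1
    change (X.presheaf.map (homOfLE _).op ≫ X.presheaf.map (homOfLE _).op) (ρ a) =
      X.presheaf.map (homOfLE _).op (ρ a)
    rw [← Functor.map_comp, ← op_comp]
    rfl

end Dictionary

/-! ## §3 Finiteness of the module Čech cohomology on a proper scheme over an affine noetherian base -/

section Finite

open Literature.AlgebraicGeometry.Morphisms Literature.AlgebraicGeometry.HodgeTheory Literature.AlgebraicGeometry.Motives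

variable {X B : Scheme.{0}} (g : X ⟶ B) [IsAffine B] [IsProper g] [IsLocallyNoetherian B]
  {ι : Type} [LinearOrder ι] [Fintype ι] (U : ι → X.Opens) (hcov : ⨆ i, U i = ⊤)
  (hUa : ∀ s : Finset ι, s.Nonempty → IsAffineOpen (cechOpen U s)) (G : X.Modules)

omit [IsProper g] [IsLocallyNoetherian B] [LinearOrder ι] [Fintype ι] in
/-- The structure map of the `Γ(B, 𝒪_B)`-scheme `X → B ≅ Spec Γ(B, 𝒪_B)` on global sections is `g♯`.
[folklore] -/
private theorem scalarRingHomTop_mk_comp_isoSpec (c : Γ(B, ⊤)) :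
    scalarRingHomTop (Over.mk (g ≫ B.isoSpec.hom) : Over (Spec (CommRingCat.of Γ(B, ⊤)))) c = g.appTop c := by
  rw [scalarRingHomTop_apply]
  change (g ≫ B.isoSpec.hom).appTop _ = _
  rw [Scheme.Hom.comp_appTop, Scheme.isoSpec, asIso_hom, Scheme.toSpecΓ_appTop, CategoryTheory.comp_apply]
  change g.appTop ((Scheme.ΓSpecIso Γ(B, ⊤)).hom ((Scheme.ΓSpecIso Γ(B, ⊤)).inv c)) = g.appTop c
  rw [Iso.inv_hom_id_apply]

include hcov hUa in
omit [IsProper g] [IsLocallyNoetherian B] in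
/-- **`Extⁿ⁺¹_{𝒪_X}(𝒪_X, G) ≃ Hⁿ⁺¹(Č•(𝓤, G))`, `Γ(B, 𝒪_B)`-semilinearly**, for `g : X → B` with `B` affine, `G`
affine-localizing (e.g. quasi-coherent) and a finite cover `𝓤` of `X` with affine finite intersections: ordered
Leray (`Modules/CechOrderedComputesCohomology`, Görtz–Wedhorn II Thm. 22.9) read in the module Čech complex
through the dictionary of §2; the scalar `c ∈ Γ(B, 𝒪_B)` acts on `Ext` through `𝒪_X`-linearity over
`B ≅ Spec Γ(B, 𝒪_B)` (`Modules/LinearOverBase`) and on `Č•(𝓤, G)` through `g♯`.  No properness or noetherian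
hypothesis here. [cite: GortzWedhorn2023, Thm. 22.9 (p. 236)] [cite: Hartshorne1977, III Thm. 4.5] -/
theorem exists_ext_addEquiv_homology_cechComplex (hG : IsAffineLocalizing G) (n : ℕ) :
    letI : Linear Γ(B, ⊤) X.Modules :=
      instLinearOverBase (Over.mk (g ≫ B.isoSpec.hom) : Over (Spec (CommRingCat.of Γ(B, ⊤))))
    ∃ f : Ext.{1} (unitModule X) G (n + 1) ≃+ (cechComplex U G g.appTop.hom).homology ((n + 1 : ℕ) : ℤ),
      ∀ (c : Γ(B, ⊤)) (x : Ext.{1} (unitModule X) G (n + 1)), f (c • x) = c • f x := by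
  classical
  let X'' : Over (Spec (CommRingCat.of Γ(B, ⊤))) := Over.mk (g ≫ B.isoSpec.hom)
  letI : Linear Γ(B, ⊤) X.Modules := instLinearOverBase X''
  have hUa' : ∀ s : Finset ι, s.Nonempty → IsAffineOpen (CechOrd.faceSet U s) := fun s hs => by
    rw [faceSet_eq_cechOpen]; exact hUa s hs
  -- the two complexes and the degreewise dictionary
  let ρ : Γ(B, ⊤) →+* Γ(X, ⊤) := g.appTop.hom
  obtain ⟨eC, heC, hsC⟩ := exists_cechSectionsAddEquiv U G ρ
  let K : CochainComplex AddCommGrpCat.{1} ℕ := CechOrd.homComplex U G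
  let L : CochainComplex (ModuleCat.{0} Γ(B, ⊤)) ℤ := cechComplex U G ρ
  let e : ∀ m : ℕ, (K.X m : Type 1) ≃+ (L.X (m : ℤ) : Type) := fun m =>
    (CechOrd.homTopAddEquiv U G m).trans (eC m)
  have hLd : ∀ (m : ℕ) (y : L.X (m : ℤ)),
      (L.d (m : ℤ) ((m + 1 : ℕ) : ℤ)).hom y = OrderedCech.sysD (sectionsSystem U G ρ) (m : ℤ) y := fun m y => by
    change (L.d (m : ℤ) ((m : ℤ) + 1)).hom y = _
    rw [OrderedCech.sysComplex_d]
    rfl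
  have he : ∀ (m : ℕ) (x : K.X m),
      e (m + 1) ((K.d m (m + 1)).hom x) = (L.d (m : ℤ) ((m + 1 : ℕ) : ℤ)).hom (e m x) := by
    intro m x
    rw [hLd]
    change eC (m + 1) (CechOrd.homTopAddEquiv U G (m + 1) (((CechOrd.homComplex U G).d m (m + 1)).hom x)) =
      OrderedCech.sysD (sectionsSystem U G ρ) (m : ℤ) (eC m (CechOrd.homTopAddEquiv U G m x))
    rw [CechOrd.homTopAddEquiv_d, ← heC]
  -- `Ext ≃+ Hⁿ⁺¹(K) ≃+ Hⁿ⁺¹(L)`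
  let E := CechOrd.extUnitAddEquivHomologySucc U G hUa' hcov hG n
  let T := HomologyTransfer.homologyAddEquiv e he n
  refine ⟨E.trans T, fun c x => ?_⟩
  -- semilinearity through the naturality of Leray in the module
  let φ : G ⟶ G := c • 𝟙 G
  let ψ : K ⟶ K := AcyclicResolution.extComplexMap (unitModule X) (CechOrd.mapComplex U φ)
  have h1 : E (c • x) = (HomologicalComplex.homologyMap ψ (n + 1)).hom (E x) := by
    rw [Ext.smul_eq_comp_mk₀]
    exact (CechOrd.extUnitAddEquivHomologySucc_naturality U φ hUa' hcov hG hG n x).symm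
  have hψ : ∀ (m : ℕ) (y : K.X m), e m ((ψ.f m).hom y) = c • e m y := by
    intro m y
    -- on cochains, `ψ` is multiplication by the global function `g♯(c)`
    have hcoch : CechOrd.homTopAddEquiv U G m ((ψ.f m).hom y) = ρ c • CechOrd.homTopAddEquiv U G m y := by
      funext β
      rw [CechOrd.homTopAddEquiv_map, Cech.obj_smul_apply]
      change ((show Γ(X, ⊤) from scalarRingHomTop X'' c) • 𝟙 G).app _ _ = _
      rw [smul_app_apply, Scheme.Modules.Hom.id_app]
      change X.presheaf.map _ (scalarRingHomTop (Over.mk (g ≫ B.isoSpec.hom)) c) • _ = _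
      rw [scalarRingHomTop_mk_comp_isoSpec]
      rfl
    change eC m (CechOrd.homTopAddEquiv U G m ((ψ.f m).hom y)) = c • eC m (CechOrd.homTopAddEquiv U G m y)
    rw [hcoch, hsC]
  have h2 := HomologyTransfer.homologyAddEquiv_homologyMap_of_smul e he hψ n (E x)
  change T (E (c • x)) = c • T (E x)
  rw [h1, h2]

include hcov hUa in
/-- **`Hⁿ⁺¹(Č•(𝓤, G))` is a finitely generated `Γ(B, 𝒪_B)`-module** for `G` coherent on `g : X → B` proper, `B`
affine locally noetherian, and `𝓤` a finite cover with affine finite intersections (`Extⁿ⁺¹_{𝒪_X}(𝒪_X, G)` is,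
Görtz–Wedhorn II Cor. 23.18 over the affine noetherian base = `Morphisms/ProperCoherentCohomologyFiniteOverRing`,
and `exists_ext_addEquiv_homology_cechComplex`). [cite: GortzWedhorn2023, Thm. 22.9 (p. 236); Cor. 23.18 (p. 307)] [cite: EGAIII1, Thm. 3.2.1] -/
theorem module_finite_homology_cechComplex_succ_of_isProper (hG : Coh G) (n : ℕ) :
    Module.Finite Γ(B, ⊤) ((cechComplex U G g.appTop.hom).homology ((n + 1 : ℕ) : ℤ)) := by
  let X'' : Over (Spec (CommRingCat.of Γ(B, ⊤))) := Over.mk (g ≫ B.isoSpec.hom)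
  haveI : IsProper X''.hom := inferInstanceAs (IsProper (g ≫ B.isoSpec.hom))
  haveI : IsNoetherianRing Γ(B, ⊤) := IsLocallyNoetherian.component_noetherian ⟨⊤, isAffineOpen_top B⟩
  letI : Linear Γ(B, ⊤) X.Modules := instLinearOverBase X''
  obtain ⟨f, hf⟩ := exists_ext_addEquiv_homology_cechComplex g U hcov hUa G hG.loc n
  haveI : Module.Finite Γ(B, ⊤) (Ext.{1} (unitModule X) G (n + 1)) :=
    module_finite_ext_unit_of_isProper X'' G hG (n + 1)
  exact Module.Finite.of_addEquiv_semilinear (RingHom.id _) Function.surjective_id f.symm (fun c y => by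
    apply f.injective
    rw [AddEquiv.apply_symm_apply, hf, AddEquiv.apply_symm_apply]
    rfl)

include hcov in
omit [Fintype ι] in
/-- **`H⁰(Č•(𝓤, G)) = Γ(X, G)` is a finitely generated `Γ(B, 𝒪_B)`-module** for `G` coherent on `g : X → B`
proper, `B` affine locally noetherian (`Modules/ModuleCechHZero.kerDZeroEquiv` and the finiteness of global sections
of coherent modules under proper morphisms, Görtz–Wedhorn II Thm. 23.17 for `i = 0`).
[cite: GortzWedhorn2023, Thm. 23.17 (p. 306); Lemma 21.65 (p. 179)] -/
theorem module_finite_homology_cechComplex_zero_of_isProper (hG : Coh G) :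
    Module.Finite Γ(B, ⊤) ((cechComplex U G g.appTop.hom).homology 0) := by
  haveI : IsNoetherianRing Γ(B, ⊤) := IsLocallyNoetherian.component_noetherian ⟨⊤, isAffineOpen_top B⟩
  let f : X ⟶ Spec (CommRingCat.of Γ(B, ⊤)) := g ≫ B.isoSpec.hom
  haveI : IsProper f := inferInstanceAs (IsProper (g ≫ B.isoSpec.hom))
  let ρ : Γ(B, ⊤) →+* Γ(X, ⊤) := g.appTop.hom
  let L : CochainComplex (ModuleCat.{0} Γ(B, ⊤)) ℤ := cechComplex U G ρ
  -- `Γ(X, G)` is finite over `Γ(B, 𝒪_B)`: the two actions on `Γ(G, ⊤)` (through `g♯` and through the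
  -- structure map of `f = g ≫ (B ≅ Spec Γ(B, 𝒪_B))`) agree
  haveI : Module.Finite Γ(B, ⊤) (MSections f G ⊤) := moduleFinite_msections_of_coh f hG
  haveI : Module.Finite Γ(B, ⊤) (SecMod G ρ ⊤) :=
    Module.Finite.of_addEquiv_semilinear (M := SecMod G ρ ⊤) (N := MSections f G ⊤) (RingHom.id _)
      Function.surjective_id (AddEquiv.refl _) (fun c x => by
        change toSections ρ ⊤ c • SecMod.val (L := G) (ρ := ρ) x =
          (show Γ(X, ⊤) from algebraMap Γ(B, ⊤) (Sections f ⊤) c) • SecMod.val (L := G) (ρ := ρ) x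
        rw [Sections.algebraMap_apply]
        congr 1
        change X.presheaf.map (homOfLE le_top).op (g.appTop c) =
          X.presheaf.map (homOfLE le_top).op (scalarRingHomTop (Over.mk (g ≫ B.isoSpec.hom)) c)
        rw [scalarRingHomTop_mk_comp_isoSpec])
  -- `Γ(X, G) ≃ ker d⁰ = Z⁰ ≅ H⁰`
  let e₁ : SecMod G ρ ⊤ ≃ₗ[Γ(B, ⊤)] LinearMap.ker (OrderedCech.sysD (sectionsSystem U G ρ) 0) := kerDZeroEquiv U G ρ hcov
  have hd : L.d 0 1 = ModuleCat.ofHom (OrderedCech.sysD (sectionsSystem U G ρ) 0) := OrderedCech.sysComplex_d _ 0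
  let e₂ : LinearMap.ker (OrderedCech.sysD (sectionsSystem U G ρ) 0) ≃ₗ[Γ(B, ⊤)] LinearMap.ker (L.d 0 1).hom :=
    LinearEquiv.ofEq _ _ (by rw [hd]; rfl)
  let e₃ : LinearMap.ker (L.d 0 1).hom ≃ₗ[Γ(B, ⊤)] L.cycles 0 := (cyclesIsoKer L 0 1 (by norm_num)).toLinearEquiv.symm
  have h0 : L.d (-1) 0 = 0 :=
    (OrderedCech.isZero_sysComplex_X_of_neg (sectionsSystem U G ρ) (-1) (by norm_num)).eq_of_src _ _
  let e₄ : L.cycles 0 ≃ₗ[Γ(B, ⊤)] L.homology 0 := (L.isoHomologyπ (-1) 0 (by simp) h0).toLinearEquiv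
  exact Module.Finite.equiv (e₁.trans (e₂.trans (e₃.trans e₄)))

include hcov hUa in
/-- **Görtz–Wedhorn II Thm. 23.17 / Cor. 23.18 in the module Čech dialect**: for `g : X → B` proper, `B` affine
locally noetherian, `G` coherent and a finite cover `𝓤` of `X` with affine finite intersections, EVERY
`Hⁱ(Č•(𝓤, G))` (`i ∈ ℤ`, base ring `g♯ : Γ(B, 𝒪_B) → Γ(X, 𝒪_X)`) is a finitely generated `Γ(B, 𝒪_B)`-module.
(For `X = P ×_K T → T` this is ★ `Modules/ModuleCechPerfect.module_finite_homology_cechComplex`, proved there by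
dévissage over the strata of `T`; here for an arbitrary proper `X → B`, e.g. an abelian scheme over an affine base.)
[cite: GortzWedhorn2023, Thm. 23.17 and Cor. 23.18 (pp. 306–307)] [cite: EGAIII1, Thm. 3.2.1] [cite: MumfordAV1970, §5, Lemma 1] -/
theorem module_finite_homology_cechComplex_of_isProper (hG : Coh G) (i : ℤ) :
    Module.Finite Γ(B, ⊤) ((cechComplex U G g.appTop.hom).homology i) := by
  by_cases hi : 0 ≤ i
  · obtain ⟨n, rfl⟩ := Int.eq_ofNat_of_zero_le hi
    cases n with
    | zero => exact module_finite_homology_cechComplex_zero_of_isProper g U hcov G hG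
    | succ n => exact module_finite_homology_cechComplex_succ_of_isProper g U hcov hUa G hG n
  · haveI : Subsingleton ((cechComplex U G g.appTop.hom).homology i) :=
      ModuleCat.subsingleton_of_isZero (ShortComplex.isZero_homology_of_isZero_X₂ _
        (OrderedCech.isZero_sysComplex_X_of_neg (sectionsSystem U G g.appTop.hom) i (by omega)))
    infer_instance

end Finite

end Literature.AlgebraicGeometry.Modules

end
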